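import Mathlib
import HarnessLib
import Summits.ResolutionOfSingularities.ResolutionOfSingularities.Theorems.WildQuotientsWildQuotientResolutionS1aKillFamily

/-!
# S1a — THE KILL-OPEN OF A PRINCIPAL CENTRE MEETS THE BAD LOCUS IN A CLOPEN SET (G1 consequences), and the ONE-CENTRE form of (K)

[OURS · L1 W4.5c · lead-1 g9] — NOT statements of the manuscript; counted 0; AI-level work, weaker than expert review. Crux
stmt-ResolutionOfSingularities-17941, line `s1a-logminvertex` v7, registered research stub `stub_killFamilyReach`. Route-independent.

For a PRINCIPAL centre `(𝒦, d)` on a model over a Noetherian base (`G = ⟨g₀⟩`, `p` prime):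
* `support_subset_principalKillOpen` — `supp 𝒦_d ⊆ principalKillOpen 𝒦 d` (a point of the support has no idle chart);
* ★ `badLocus_inter_principalKillOpen_eq` — `badLocus ∩ principalKillOpen 𝒦 d = badLocus ∩ supp 𝒦_d` (⊆ is G1 = `g1`, p612119); hence this trace is
  CLOPEN in the bad locus (`isClopen_badLocus_inter_support`): open as the trace of the kill-open, closed as the trace of the support;
* ★ `hitsComponents_iff_badLocus_subset_support` — the KILL clause of the rule of record «the kill-open meets every irreducible component of the
  bad locus» is EQUIVALENT to «`badLocus ⊆ supp 𝒦_d`» (an irreducible component is preconnected, so it lies inside the clopen trace once it meets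
  it), and to «the principal charts cover the bad locus» (`cover_iff_badLocus_subset_support`);
* `connectedComponentIn_badLocus_subset_support` — a principal centre whose kill-open touches a bad point `v` carries the whole CONNECTED COMPONENT
  of the bad locus through `v` inside its support: kills cannot be localised below connected components of `Z(M)`;
* ★ `exists_family_iff_exists_support` — at a model, the FAMILY form of (K) (finitely many principal centres of one degree with pairwise disjoint
  supports whose kill-opens cover the bad locus — the body of `KillFamilyReach`, p614162) is EQUIVALENT to the ONE-CENTRE form «some principal
  centre has `badLocus ⊆ supp 𝒦_d`» (`infRees` gluing one way, the singleton family the other). So the disjoint-family packaging of the registered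
  stub is inessential: (K) reads «at every reachable all-killable model the bad locus lies in the support of ONE principal centre».
-/

set_option linter.dupNamespace false

noncomputable section

universe u

open CategoryTheory Limits AlgebraicGeometry TopologicalSpace Topology
open Literature.AlgebraicGeometry.Resolution Literature.AlgebraicGeometry.RelativeSpec
open Summit.ResolutionOfSingularities.ResolutionOfSingularities.Theorems.WildQuotientResolution.S1
open Summit.ResolutionOfSingularities.ResolutionOfSingularities.Theorems.WildQuotientResolution.S1.NodeAtlas
open Summit.ResolutionOfSingularities.ResolutionOfSingularities.Theorems.WildQuotientResolution.S1.BlowupCharts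
open Summit.ResolutionOfSingularities.ResolutionOfSingularities.Theorems.WildQuotientResolution.S1.G1Proof
open Summit.ResolutionOfSingularities.ResolutionOfSingularities.Theorems.WildQuotientResolution.S1.KillFamily
open Summit.ResolutionOfSingularities.ResolutionOfSingularities.Theorems.WildQuotientResolution.S1.CentreGluing

namespace Summit.ResolutionOfSingularities.ResolutionOfSingularities.Theorems.WildQuotientResolution.S1.KillClopen

variable {p : ℕ} {X' X₁ : Scheme.{0}} {q : X' ⟶ X₁} {G : Type} [Group G] {ρ : G →* Aut X'} {g₀ : G}

/-! ## Support versus kill-open -/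

/-- **The support of a principal centre lies in its kill-open**: a point of `supp 𝒦_d` has no idle chart, so its chart from the
principal-centre cover is a principal-centre chart. [OURS · L1 W4.5c] -/
theorem support_subset_principalKillOpen (M : GameFrame.GModel p q G ρ g₀) {𝒦 : ReesFiltration M.V} {d : ℕ}
    (hprin : IsPrincipalCentre p M.act g₀ 𝒦 d) :
    ((𝒦.ideal d).support : Set M.V) ⊆ M.principalKillOpen 𝒦 d := by
  intro v hv
  obtain ⟨O, hvO, hO | hO⟩ := hprin.2.2 v
  · exact Set.mem_iUnion.mpr ⟨O, Set.mem_iUnion.mpr ⟨hO, hvO⟩⟩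
  · exfalso
    have hdisj := disjoint_support_of_ideal_eq_top (I := 𝒦.ideal d) hO.1.1
      (by rw [← ReesFiltration.filtration_ideal]; exact hO.2 d)
    exact Set.disjoint_left.mp hdisj hvO hv

/-- ★ **`badLocus ∩ principalKillOpen = badLocus ∩ supp`** for a principal centre on a model over a Noetherian base: `⊆` is the support
lemma G1 (`g1`), `⊇` is `support_subset_principalKillOpen`. [OURS · L1 W4.5c] -/
theorem badLocus_inter_principalKillOpen_eq [Finite G] (hp : p.Prime) (hG : ∀ g : G, g ∈ Subgroup.zpowers g₀)
    (M : GameFrame.GModel p q G ρ g₀) (hB : M.HasNoetherianBase) {𝒦 : ReesFiltration M.V} {d : ℕ}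
    (hprin : IsPrincipalCentre p M.act g₀ 𝒦 d) :
    M.badLocus ∩ M.principalKillOpen 𝒦 d = M.badLocus ∩ ((𝒦.ideal d).support : Set M.V) := by
  ext v
  refine ⟨fun ⟨hv, hvU⟩ => ⟨hv, ?_⟩, fun ⟨hv, hvs⟩ => ⟨hv, support_subset_principalKillOpen M hprin hvs⟩⟩
  obtain ⟨O, hO'⟩ := Set.mem_iUnion.mp hvU
  obtain ⟨hO, hvO⟩ := Set.mem_iUnion.mp hO'
  exact g1 hp q G ρ g₀ hG M 𝒦 d O hB hO v hvO hv

/-- A bad point of the kill-open of a principal centre lies in the support (pointwise form). [OURS · L1 W4.5c] -/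
theorem mem_support_of_mem_badLocus_of_mem_principalKillOpen [Finite G] (hp : p.Prime) (hG : ∀ g : G, g ∈ Subgroup.zpowers g₀)
    (M : GameFrame.GModel p q G ρ g₀) (hB : M.HasNoetherianBase) {𝒦 : ReesFiltration M.V} {d : ℕ}
    (hprin : IsPrincipalCentre p M.act g₀ 𝒦 d) {v : M.V} (hv : v ∈ M.badLocus) (hvU : v ∈ M.principalKillOpen 𝒦 d) :
    v ∈ ((𝒦.ideal d).support : Set M.V) :=
  ((Set.ext_iff.mp (badLocus_inter_principalKillOpen_eq hp hG M hB hprin) v).mp ⟨hv, hvU⟩).2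

/-- ★ **The trace of the support (= of the kill-open) of a principal centre on the bad locus is CLOPEN in the bad locus.** [OURS · L1 W4.5c] -/
theorem isClopen_badLocus_inter_support [Finite G] (hp : p.Prime) (hG : ∀ g : G, g ∈ Subgroup.zpowers g₀)
    (M : GameFrame.GModel p q G ρ g₀) (hB : M.HasNoetherianBase) {𝒦 : ReesFiltration M.V} {d : ℕ}
    (hprin : IsPrincipalCentre p M.act g₀ 𝒦 d) :
    IsClopen {z : ↥M.badLocus | (z : M.V) ∈ ((𝒦.ideal d).support : Set M.V)} := by
  constructor
  · exact (𝒦.ideal d).support.isClosed.preimage continuous_subtype_val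
  · have h : {z : ↥M.badLocus | (z : M.V) ∈ ((𝒦.ideal d).support : Set M.V)} =
        {z : ↥M.badLocus | (z : M.V) ∈ M.principalKillOpen 𝒦 d} := by
      ext z
      have := Set.ext_iff.mp (badLocus_inter_principalKillOpen_eq hp hG M hB hprin) z
      simp only [Set.mem_inter_iff, Set.mem_setOf_eq] at this ⊢
      exact ⟨fun hz => (this.mpr ⟨z.2, hz⟩).2, fun hz => (this.mp ⟨z.2, hz⟩).2⟩
    rw [h]
    exact (M.isOpen_principalKillOpen 𝒦 d).preimage continuous_subtype_val

/-! ## The KILL clause of the rule of record is «bad locus inside the support» -/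

/-- ★ **Hitting every irreducible component of the bad locus ⟺ `badLocus ⊆ supp 𝒦_d`** (principal centre, Noetherian base): an irreducible
component is preconnected, so once it meets the clopen trace of the support it lies inside it; and every bad point lies on some component.
[OURS · L1 W4.5c] -/
theorem hitsComponents_iff_badLocus_subset_support [Finite G] (hp : p.Prime) (hG : ∀ g : G, g ∈ Subgroup.zpowers g₀)
    (M : GameFrame.GModel p q G ρ g₀) (hB : M.HasNoetherianBase) {𝒦 : ReesFiltration M.V} {d : ℕ}
    (hprin : IsPrincipalCentre p M.act g₀ 𝒦 d) :
    (∀ t ∈ irreducibleComponents ↥M.badLocus, ∃ x ∈ t, (x : M.V) ∈ M.principalKillOpen 𝒦 d) ↔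
      M.badLocus ⊆ ((𝒦.ideal d).support : Set M.V) := by
  constructor
  · intro h v hv
    -- the component of `v`
    let t : Set ↥M.badLocus := irreducibleComponent (⟨v, hv⟩ : ↥M.badLocus)
    obtain ⟨x, hxt, hxU⟩ := h t (irreducibleComponent_mem_irreducibleComponents _)
    have hxs : (x : M.V) ∈ ((𝒦.ideal d).support : Set M.V) :=
      mem_support_of_mem_badLocus_of_mem_principalKillOpen hp hG M hB hprin x.2 hxU
    have hsub : t ⊆ {z : ↥M.badLocus | (z : M.V) ∈ ((𝒦.ideal d).support : Set M.V)} :=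
      (isIrreducible_irreducibleComponent.isPreirreducible.isPreconnected).subset_isClopen
        (isClopen_badLocus_inter_support hp hG M hB hprin) ⟨x, hxt, hxs⟩
    exact hsub (mem_irreducibleComponent (x := (⟨v, hv⟩ : ↥M.badLocus)))
  · intro h t ht
    obtain ⟨x, hx⟩ := ht.1.nonempty
    exact ⟨x, hx, support_subset_principalKillOpen M hprin (h x.2)⟩

/-- **Covering the bad locus by principal charts ⟺ `badLocus ⊆ supp 𝒦_d`.** [OURS · L1 W4.5c] -/
theorem cover_iff_badLocus_subset_support [Finite G] (hp : p.Prime) (hG : ∀ g : G, g ∈ Subgroup.zpowers g₀)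
    (M : GameFrame.GModel p q G ρ g₀) (hB : M.HasNoetherianBase) {𝒦 : ReesFiltration M.V} {d : ℕ}
    (hprin : IsPrincipalCentre p M.act g₀ 𝒦 d) :
    M.badLocus ⊆ M.principalKillOpen 𝒦 d ↔ M.badLocus ⊆ ((𝒦.ideal d).support : Set M.V) :=
  ⟨fun h _ hv => mem_support_of_mem_badLocus_of_mem_principalKillOpen hp hG M hB hprin hv (h hv),
    fun h _ hv => support_subset_principalKillOpen M hprin (h hv)⟩

/-- **A principal centre touching a bad point carries the whole connected component of the bad locus through it in its support**:
`connectedComponentIn badLocus v ⊆ supp 𝒦_d` for `v ∈ badLocus ∩ supp 𝒦_d`. Kills cannot be localised below connected components of `Z(M)`.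
[OURS · L1 W4.5c] -/
theorem connectedComponentIn_badLocus_subset_support [Finite G] (hp : p.Prime) (hG : ∀ g : G, g ∈ Subgroup.zpowers g₀)
    (M : GameFrame.GModel p q G ρ g₀) (hB : M.HasNoetherianBase) {𝒦 : ReesFiltration M.V} {d : ℕ}
    (hprin : IsPrincipalCentre p M.act g₀ 𝒦 d) {v : M.V} (hv : v ∈ M.badLocus) (hvs : v ∈ ((𝒦.ideal d).support : Set M.V)) :
    connectedComponentIn M.badLocus v ⊆ ((𝒦.ideal d).support : Set M.V) := by
  rw [connectedComponentIn_eq_image hv]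
  rintro _ ⟨z, hz, rfl⟩
  have hsub : connectedComponent (⟨v, hv⟩ : ↥M.badLocus) ⊆ {z : ↥M.badLocus | (z : M.V) ∈ ((𝒦.ideal d).support : Set M.V)} :=
    isPreconnected_connectedComponent.subset_isClopen (isClopen_badLocus_inter_support hp hG M hB hprin)
      ⟨⟨v, hv⟩, mem_connectedComponent, hvs⟩
  exact hsub hz

/-- The same with the kill-open in place of the support as the witness of touching. [OURS · L1 W4.5c] -/
theorem connectedComponentIn_badLocus_subset_principalKillOpen [Finite G] (hp : p.Prime) (hG : ∀ g : G, g ∈ Subgroup.zpowers g₀)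
    (M : GameFrame.GModel p q G ρ g₀) (hB : M.HasNoetherianBase) {𝒦 : ReesFiltration M.V} {d : ℕ}
    (hprin : IsPrincipalCentre p M.act g₀ 𝒦 d) {v : M.V} (hv : v ∈ M.badLocus) (hvU : v ∈ M.principalKillOpen 𝒦 d) :
    connectedComponentIn M.badLocus v ⊆ M.principalKillOpen 𝒦 d := fun _ hz =>
  support_subset_principalKillOpen M hprin
    (connectedComponentIn_badLocus_subset_support hp hG M hB hprin hv
      (mem_support_of_mem_badLocus_of_mem_principalKillOpen hp hG M hB hprin hv hvU) hz)

/-! ## The family form of (K) at a model is the one-centre form -/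

/-- ★ **FAMILY FORM ⟺ ONE-CENTRE FORM at a model** (principal centres, Noetherian base): «finitely many principal centres of one degree `d > 0` with
pairwise disjoint supports whose kill-opens cover the bad locus» ⟺ «ONE principal centre `(𝒦, d)`, `d > 0`, with `badLocus ⊆ supp 𝒦_d`».
(`⇒`: glue by `infRees`, `exists_killCover_of_family` p614162, then `cover_iff_badLocus_subset_support`; `⇐`: the singleton family.)
[OURS · L1 W4.5c] -/
theorem exists_family_iff_exists_support [Finite G] (hp : p.Prime) (hG : ∀ g : G, g ∈ Subgroup.zpowers g₀)
    (M : GameFrame.GModel p q G ρ g₀) (hB : M.HasNoetherianBase) :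
    (∃ (n : ℕ) (𝒦 : Fin n → ReesFiltration M.V) (d : ℕ), 0 < d ∧ (∀ i, IsPrincipalCentre p M.act g₀ (𝒦 i) d) ∧
        (Pairwise fun i j => Disjoint (((𝒦 i).ideal d).support : Set M.V) ((𝒦 j).ideal d).support) ∧
        M.badLocus ⊆ ⋃ i, M.principalKillOpen (𝒦 i) d) ↔
      ∃ (𝒦 : ReesFiltration M.V) (d : ℕ), IsPrincipalCentre p M.act g₀ 𝒦 d ∧ M.badLocus ⊆ ((𝒦.ideal d).support : Set M.V) := by
  constructor
  · rintro ⟨n, 𝒦, d, hd, hprin, hdisj, hcov⟩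
    refine ⟨infRees 𝒦, d, isPrincipalCentre_infRees_of_disjoint M 𝒦 hd hprin hdisj, ?_⟩
    rw [← cover_iff_badLocus_subset_support hp hG M hB (isPrincipalCentre_infRees_of_disjoint M 𝒦 hd hprin hdisj)]
    intro v hv
    obtain ⟨i₀, hvi⟩ := Set.mem_iUnion.mp (hcov hv)
    exact badLocus_inter_subset_principalKillOpen_infRees hp hG M hB 𝒦 hd hprin hdisj i₀ ⟨hv, hvi⟩
  · rintro ⟨𝒦, d, hprin, hsub⟩
    refine ⟨1, fun _ => 𝒦, d, hprin.1, fun _ => hprin, fun i j hij => absurd (Subsingleton.elim i j) hij, fun v hv => ?_⟩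
    exact Set.mem_iUnion.mpr ⟨0, support_subset_principalKillOpen M hprin (hsub hv)⟩

end Summit.ResolutionOfSingularities.ResolutionOfSingularities.Theorems.WildQuotientResolution.S1.KillClopen

end
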